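import Summits.BirchSwinnertonDyer.BirchSwinnertonDyer.Theorems.GenusKolyvaginAtTwoTorsionCellGenusTrace
import Summits.BirchSwinnertonDyer.BirchSwinnertonDyer.Theorems.GenusKolyvaginAtTwoTorsionCellTorsionControl
import Literature.NumberTheory.EllipticCurves.GaloisAction
import HarnessLib

/-!
# LINE 49 «full_vertex» — the genus trace of a half ON POINTS: cocycle discharged, `E(L)` under `Gal(L/F)` with full `2`-torsion

Crux R″ `RankOneTwoTorsionResidualAtTwo` (stmt-BirchSwinnertonDyer-27478) of route GenusKolyvaginAtTwo, LINE 49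
«torsion_cell_full_vertex_bsdidea1» (pen bsd-idea-1); sequel of `…GenusTrace` (the pen's brick `GenusTrace.lean` r2: the
dictionary lemma `Tr_G R_v = 2^(k−1)[D∈v] z′` of Theorem D, memo #6 §5.7, with the cocycle sum `∑_σ e_v(σ) = 0` as a
HYPOTHESIS).  Here that hypothesis is DISCHARGED from the eigen-data, and the lemma is read on the object of the memo:

* §1 (any `DistribMulAction` of a finite group `G` of exponent `2`, `|G| = 2^k`, `k ≥ 2`, on `A` whose `2`-torsion is
  `G`-fixed): `units_smul_sub_self_add_ite`, `cocycle_termwise` (termwise `±1` identities); **`two_nsmul_cocycle_eq_zero`** —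
  the Kummer cocycle `e σ := σ • R − R + ∑_{d∈v, χ_d(σ)=−1} g d` of a half `R` (`2 • R = ∑_{d∈v} g d + t`, `σ • g d = χ d σ • g d`,
  `σ • t = t`) is `2`-torsion-valued; **`cocycle_mul`** — if `σ` fixes `e τ` then `e (στ) = e σ + e τ`; hence
  **`trace_half_eq_smul`** / `trace_half_eq_smul_four`: `∑ σ, σ • R = [D ∈ v] • 2^(k−1) • g D` from the eigen-data ALONE
  (`…GenusTrace.sum_eq_zero_of_mul_of_sq_eq_one` kills the cocycle sum, `…GenusTrace.trace_half_eq_pow` concludes).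
* §2 (the object itself): `E(L) = (W.baseChange L).toAffine.Point` for `W/F` with RATIONAL `2`-TORSION
  (`W.toAffine.SplitTwoTorsion e₁ e₂ e₃`, tree `TwoDescent.lean`) under the tree's Galois action
  (`WeierstrassCurve.instDistribMulActionAlgEquivPoint`, `GaloisAction.lean`): **`smul_eq_self_of_two_nsmul_eq_zero`** —
  `E(L)[2] = E(F)[2]` is `Aut(L/F)`-fixed (tree `…TorsionControl.mem_range_map_of_add_self_eq_zero` + `conjMap_incl`);
  **`trace_half_eq_point`** / `trace_half_eq_point_four` — for `Aut(L/F)` of exponent `2` and order `2^k` (`k ≥ 2`; the genus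
  field `K_gen/K`), `χ d`-eigenvectors `g d ∈ E(L)` (the odd-twist generators `g′_d`, eigen by `…GenusDepthTwistEigen`),
  `t ∈ E(L)[2]` and a half `R ∈ E(L)` of `∑_{d∈v} g d + t`:  `Tr R := ∑ σ, σ • R = 2^(k−1) • g D` if `D ∈ v`, else `0`.

Dictionary (memo #6 §5.7): `F = K`, `L = K_gen`, `W = E₀/K` (full rational `2`-torsion), `g D = z′`, `R = R_v`; so every
genus trace `Tr_{K_gen/K} R_v` lies in `2^(k−1) ℤ z′` — the input «the genus-trace functional kills `Λ̃_{≤1}`» of Theorem D.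
No Heegner point, component group or `L`-function occurs here; the functional `S0` and its Heegner-safety are the pen's
PAPER steps.  Everything is proved (no `sorry`, standard axioms); nothing here is a statement of the line, and NOTHING HERE
PROVES R″ or any summit — BSD is not advanced by this file alone.

## References

* [SilvermanAEC2009] J. H. Silverman, *The Arithmetic of Elliptic Curves*, 2nd ed. (2009), VIII.§1–§2 (Galois action,
  Kummer pairing), Prop. X.1.4 (rational `2`-torsion).
* [Serre1977] J.-P. Serre, *Linear Representations of Finite Groups*, GTM 42, §2.3.
-/

noncomputable section

namespace Summit.BirchSwinnertonDyer.BirchSwinnertonDyer.Theorems.GenusKolyvaginAtTwo.FullVertex.GenusTrace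

open BigOperators Finset

/-! ## §1 The dictionary lemma for a `DistribMulAction`, cocycle-sum hypothesis discharged -/

section Smul

variable {ι G A : Type*} [Group G] [AddCommGroup A] [DistribMulAction G A]

/-- Termwise identity behind «the Kummer cocycle of a half is `2`-torsion»: for `u = ±1`,
`(u • x − x) + [u = −1] • 2 • x = 0`. [cite: SilvermanAEC2009, VIII.§2] -/
theorem units_smul_sub_self_add_ite (u : ℤˣ) (x : A) :
    (((u : ℤ) • x - x) + if ((u : ℤ)) = -1 then (2 : ℕ) • x else 0) = 0 := by
  rcases Int.units_eq_one_or u with rfl | rfl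
  · rw [Units.val_one, one_zsmul, sub_self, if_neg (by norm_num), add_zero]
  · rw [Units.val_neg, Units.val_one, if_pos rfl, neg_one_zsmul, two_nsmul]
    abel

/-- Termwise identity behind «the Kummer cocycle of a half is a homomorphism»: for `a, b = ±1`,
`−[a = −1] • x − [b = −1] • (a • x) + [ab = −1] • x = 0`. [cite: SilvermanAEC2009, VIII.§2] -/
theorem cocycle_termwise (a b : ℤˣ) (x : A) :
    -(if ((a : ℤ)) = -1 then x else 0) - (if ((b : ℤ)) = -1 then (a : ℤ) • x else 0)
      + (if (((a * b : ℤˣ)) : ℤ) = -1 then x else 0) = 0 := by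
  rcases Int.units_eq_one_or a with rfl | rfl <;> rcases Int.units_eq_one_or b with rfl | rfl
  · simp
  · simp
  · simp
  · rw [show ((-1 : ℤˣ) * -1 : ℤˣ) = 1 from by simp, Units.val_neg, Units.val_one, if_pos rfl, if_pos rfl,
      if_neg (by norm_num), neg_one_zsmul]
    abel

/-- **The Kummer cocycle of a half takes `2`-torsion values.**  With `σ • g d = χ d σ • g d`, `σ • t = t` and
`2 • R = ∑_{d∈v} g d + t`, the cocycle `e σ := σ • R − R + ∑_{d ∈ v, χ_d(σ) = −1} g d` satisfies `2 • e σ = 0`.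
[cite: SilvermanAEC2009, VIII.§2] -/
theorem two_nsmul_cocycle_eq_zero (χ : ι → G →* ℤˣ) (g : ι → A)
    (hg : ∀ d (σ : G), σ • g d = ((χ d σ : ℤˣ) : ℤ) • g d) (v : Finset ι) (t : A) (R : A)
    (hR : (2 : ℕ) • R = (∑ d ∈ v, g d) + t) (σ : G) (hσt : σ • t = t) :
    (2 : ℕ) • (σ • R - R + ∑ d ∈ v.filter (fun d => ((χ d σ : ℤˣ) : ℤ) = -1), g d) = 0 := by
  have key : (2 : ℕ) • (σ • R - R + ∑ d ∈ v.filter (fun d => ((χ d σ : ℤˣ) : ℤ) = -1), g d)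
      = ∑ d ∈ v, ((((χ d σ : ℤˣ) : ℤ) • g d - g d) +
          if ((χ d σ : ℤˣ) : ℤ) = -1 then (2 : ℕ) • g d else 0) := by
    rw [smul_add, smul_sub, Finset.smul_sum, smul_comm (2 : ℕ) σ R, hR, smul_add, hσt, Finset.smul_sum]
    simp_rw [hg]
    rw [Finset.sum_filter, Finset.sum_add_distrib, Finset.sum_sub_distrib]
    abel
  rw [key]
  exact Finset.sum_eq_zero fun d _ => units_smul_sub_self_add_ite _ _

/-- **The Kummer cocycle of a half is a homomorphism** when it is `G`-fixed: with `σ • g d = χ d σ • g d` and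
`e σ := σ • R − R + ∑_{d ∈ v, χ_d(σ) = −1} g d`, if `σ • e τ = e τ` then `e (σ * τ) = e σ + e τ`.
[cite: SilvermanAEC2009, VIII.§2] -/
theorem cocycle_mul (χ : ι → G →* ℤˣ) (g : ι → A)
    (hg : ∀ d (σ : G), σ • g d = ((χ d σ : ℤˣ) : ℤ) • g d) (v : Finset ι) (R : A) (σ τ : G)
    (hfix : σ • (τ • R - R + ∑ d ∈ v.filter (fun d => ((χ d τ : ℤˣ) : ℤ) = -1), g d)
      = τ • R - R + ∑ d ∈ v.filter (fun d => ((χ d τ : ℤˣ) : ℤ) = -1), g d) :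
    ((σ * τ) • R - R + ∑ d ∈ v.filter (fun d => ((χ d (σ * τ) : ℤˣ) : ℤ) = -1), g d)
      = (σ • R - R + ∑ d ∈ v.filter (fun d => ((χ d σ : ℤˣ) : ℤ) = -1), g d)
        + (τ • R - R + ∑ d ∈ v.filter (fun d => ((χ d τ : ℤˣ) : ℤ) = -1), g d) := by
  have hEτ : σ • (∑ d ∈ v.filter (fun d => ((χ d τ : ℤˣ) : ℤ) = -1), g d)
      = ∑ d ∈ v, (if ((χ d τ : ℤˣ) : ℤ) = -1 then ((χ d σ : ℤˣ) : ℤ) • g d else 0) := by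
    rw [Finset.sum_filter, Finset.smul_sum]
    refine Finset.sum_congr rfl fun d _ => ?_
    split_ifs
    · exact hg d σ
    · exact smul_zero σ
  have eq2 : σ • (τ • R - R + ∑ d ∈ v.filter (fun d => ((χ d τ : ℤˣ) : ℤ) = -1), g d)
      = σ • τ • R - σ • R + ∑ d ∈ v, (if ((χ d τ : ℤˣ) : ℤ) = -1 then ((χ d σ : ℤˣ) : ℤ) • g d else 0) := by
    rw [smul_add, smul_sub, hEτ]
  have hdiff : ((σ * τ) • R - R + ∑ d ∈ v.filter (fun d => ((χ d (σ * τ) : ℤˣ) : ℤ) = -1), g d)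
      - ((σ • R - R + ∑ d ∈ v.filter (fun d => ((χ d σ : ℤˣ) : ℤ) = -1), g d)
        + (τ • R - R + ∑ d ∈ v.filter (fun d => ((χ d τ : ℤˣ) : ℤ) = -1), g d))
      = ∑ d ∈ v, (-(if ((χ d σ : ℤˣ) : ℤ) = -1 then g d else 0)
          - (if ((χ d τ : ℤˣ) : ℤ) = -1 then ((χ d σ : ℤˣ) : ℤ) • g d else 0)
          + (if (((χ d σ * χ d τ : ℤˣ)) : ℤ) = -1 then g d else 0)) := by
    rw [Finset.sum_add_distrib, Finset.sum_sub_distrib, Finset.sum_neg_distrib, ← hfix, eq2, mul_smul,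
      Finset.sum_filter, Finset.sum_filter]
    simp_rw [map_mul]
    abel
  rw [← sub_eq_zero, hdiff]
  exact Finset.sum_eq_zero fun d _ => cocycle_termwise _ _ _

/-- **DICTIONARY LEMMA for a `DistribMulAction`, cocycle discharged.**  Let the finite group `G` of exponent `2` and order
`2^k` (`k ≥ 2`) act on `A` so that every `2`-torsion element of `A` is `G`-fixed (full rational `2`-torsion).  Let `g d` be
`χ d`-eigenvectors (`χ D = 1`, `χ d ≠ 1` for `d ≠ D`), `t` with `2 • t = 0`, and `R` a HALF: `2 • R = ∑_{d∈v} g d + t`.  Then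
`∑ σ, σ • R = 2^(k−1) • g D` if `D ∈ v`, and `0` otherwise.  (The Kummer cocycle of `R` is `2`-torsion-valued, hence fixed,
hence a homomorphism, hence sums to zero — §1; then §5.)  Dictionary: `∑_σ σ • R_v = Tr_{K_gen/K} R_v = 2^(k−1)[D∈v] z′`.
[cite: Serre1977, §2.3] [cite: SilvermanAEC2009, VIII.§2] -/
theorem trace_half_eq_smul [Fintype G] [DecidableEq G] [DecidableEq ι] {k : ℕ} (hG : Fintype.card G = 2 ^ k) (hk : 2 ≤ k) (h2 : ∀ σ : G, σ * σ = 1)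
    (htors : ∀ x : A, (2 : ℕ) • x = 0 → ∀ σ : G, σ • x = x)
    (χ : ι → G →* ℤˣ) (D : ι) (hχ : ∀ d, d ≠ D → χ d ≠ 1) (hD : χ D = 1)
    (g : ι → A) (hg : ∀ d (σ : G), σ • g d = ((χ d σ : ℤˣ) : ℤ) • g d)
    (v : Finset ι) (t : A) (ht : (2 : ℕ) • t = 0) (R : A) (hR : (2 : ℕ) • R = (∑ d ∈ v, g d) + t) :
    (∑ σ : G, σ • R) = if D ∈ v then (2 ^ (k - 1) : ℕ) • g D else 0 := by
  -- the Kummer cocycle of the half `R`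
  set e : G → A := fun σ => σ • R - R + ∑ d ∈ v.filter (fun d => ((χ d σ : ℤˣ) : ℤ) = -1), g d with he_def
  have hact : ∀ σ, σ • R = R - (∑ d ∈ v.filter (fun d => ((χ d σ : ℤˣ) : ℤ) = -1), g d) + e σ := by
    intro σ; simp only [he_def]; abel
  have he2 : ∀ σ, (2 : ℕ) • e σ = 0 := fun σ =>
    two_nsmul_cocycle_eq_zero χ g hg v t R hR σ (htors t ht σ)
  have hmul : ∀ σ τ, e (σ * τ) = e σ + e τ := fun σ τ =>
    cocycle_mul χ g hg v R σ τ (htors (e τ) (he2 τ) σ)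
  have hsum : ∑ σ, e σ = 0 :=
    sum_eq_zero_of_mul_of_sq_eq_one e hmul h2 (by rw [hG]; exact (pow_dvd_pow 2 hk : 2 ^ 2 ∣ 2 ^ k))
  exact trace_half_eq_pow hG hk χ D hχ hD g v t ht R hR (fun σ x => σ • x) e hsum hact

/-- `|G| = 4` (`k = 2`, `K_gen/K` biquadratic): `∑ σ, σ • R = 2 • g D` if `D ∈ v`, else `0` — the pen's dictionary
`Tr_G R_v = 2[D∈v] z′` with NO cocycle hypothesis. [cite: Serre1977, §2.3] [cite: SilvermanAEC2009, VIII.§2] -/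
theorem trace_half_eq_smul_four [Fintype G] [DecidableEq G] [DecidableEq ι] (hG : Fintype.card G = 4) (h2 : ∀ σ : G, σ * σ = 1)
    (htors : ∀ x : A, (2 : ℕ) • x = 0 → ∀ σ : G, σ • x = x)
    (χ : ι → G →* ℤˣ) (D : ι) (hχ : ∀ d, d ≠ D → χ d ≠ 1) (hD : χ D = 1)
    (g : ι → A) (hg : ∀ d (σ : G), σ • g d = ((χ d σ : ℤˣ) : ℤ) • g d)
    (v : Finset ι) (t : A) (ht : (2 : ℕ) • t = 0) (R : A) (hR : (2 : ℕ) • R = (∑ d ∈ v, g d) + t) :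
    (∑ σ : G, σ • R) = if D ∈ v then (2 : ℕ) • g D else 0 := by
  have h := trace_half_eq_smul (k := 2) (by rw [hG]; norm_num) le_rfl h2 htors χ D hχ hD g hg v t ht R hR
  have h2' : (2 ^ (2 - 1) : ℕ) = 2 := by norm_num
  rw [h, h2']

end Smul

/-! ## §2 On `E(L)` under `Aut(L/F)`, `W/F` with rational `2`-torsion -/

section Points

open WeierstrassCurve WeierstrassCurve.QuadraticDescent
open scoped Classical

universe u

variable {F L : Type u} [Field F] [Field L] [Algebra F L] [CharZero F] [CharZero L]
  (W : WeierstrassCurve F) [W.IsElliptic] {e₁ e₂ e₃ : F}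

/-- **Rational `2`-torsion is Galois-fixed.**  If `E[2] ⊆ E(F)` (`W.toAffine.SplitTwoTorsion e₁ e₂ e₃`), then every
`P ∈ E(L)` with `2 • P = O` is fixed by every `σ ∈ Aut(L/F)` (it is `O` or a `Tᵢ = (eᵢ, ·) ∈ E(F)`, tree
`…TorsionControl.mem_range_map_of_add_self_eq_zero`, and `σ` fixes `F`-points, `conjMap_incl`).
[cite: SilvermanAEC2009, Prop. X.1.4] -/
theorem smul_eq_self_of_two_nsmul_eq_zero (h : W.toAffine.SplitTwoTorsion e₁ e₂ e₃)
    (P : (W.baseChange L).toAffine.Point) (hP : (2 : ℕ) • P = 0) (σ : L ≃ₐ[F] L) : σ • P = P := by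
  obtain ⟨Q, hQ⟩ := TorsionControl.mem_range_map_of_add_self_eq_zero h P (by rwa [two_nsmul] at hP)
  rw [← hQ, WeierstrassCurve.smul_def]
  exact conjMap_incl W (σ : L →ₐ[F] L) Q

variable [FiniteDimensional F L]

/-- **THE GENUS TRACE OF A HALF on `E(L)`.**  `W/F` with rational `2`-torsion, `Aut(L/F)` of exponent `2` and order `2^k`
(`k ≥ 2`), `χ d`-eigenvectors `g d ∈ E(L)` with `χ D = 1`, `χ d ≠ 1` (`d ≠ D`), `t ∈ E(L)` with `2 • t = O`, and a HALF
`R ∈ E(L)`: `2 • R = ∑_{d∈v} g d + t`.  Then `∑ σ, σ • R = 2^(k−1) • g D` if `D ∈ v`, else `O` — memo #6 §5.7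
«`Tr_{K_gen/K} R_v = 2^(k−1)[D∈v] z′`», with no cocycle hypothesis. [cite: SilvermanAEC2009, VIII.§2] [cite: Serre1977, §2.3] -/
theorem trace_half_eq_point (h : W.toAffine.SplitTwoTorsion e₁ e₂ e₃) {ι : Type*} {k : ℕ}
    (hG : Fintype.card (L ≃ₐ[F] L) = 2 ^ k) (hk : 2 ≤ k) (h2 : ∀ σ : L ≃ₐ[F] L, σ * σ = 1)
    (χ : ι → (L ≃ₐ[F] L) →* ℤˣ) (D : ι) (hχ : ∀ d, d ≠ D → χ d ≠ 1) (hD : χ D = 1)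
    (g : ι → (W.baseChange L).toAffine.Point)
    (hg : ∀ d (σ : L ≃ₐ[F] L), σ • g d = ((χ d σ : ℤˣ) : ℤ) • g d)
    (v : Finset ι) (t : (W.baseChange L).toAffine.Point) (ht : (2 : ℕ) • t = 0)
    (R : (W.baseChange L).toAffine.Point) (hR : (2 : ℕ) • R = (∑ d ∈ v, g d) + t) :
    (∑ σ : L ≃ₐ[F] L, σ • R) = if D ∈ v then (2 ^ (k - 1) : ℕ) • g D else 0 :=
  trace_half_eq_smul hG hk h2 (fun x hx σ => smul_eq_self_of_two_nsmul_eq_zero W h x hx σ) χ D hχ hD g hg v t ht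
    R hR

/-- `|Aut(L/F)| = 4` (the biquadratic genus field at `k = 2`): `∑ σ, σ • R = 2 • g D` if `D ∈ v`, else `O` — the pen's
`Tr_G R_v = 2[D∈v] z′` on `E₀(K_gen)`. [cite: SilvermanAEC2009, VIII.§2] [cite: Serre1977, §2.3] -/
theorem trace_half_eq_point_four (h : W.toAffine.SplitTwoTorsion e₁ e₂ e₃) {ι : Type*}
    (hG : Fintype.card (L ≃ₐ[F] L) = 4) (h2 : ∀ σ : L ≃ₐ[F] L, σ * σ = 1)
    (χ : ι → (L ≃ₐ[F] L) →* ℤˣ) (D : ι) (hχ : ∀ d, d ≠ D → χ d ≠ 1) (hD : χ D = 1)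
    (g : ι → (W.baseChange L).toAffine.Point)
    (hg : ∀ d (σ : L ≃ₐ[F] L), σ • g d = ((χ d σ : ℤˣ) : ℤ) • g d)
    (v : Finset ι) (t : (W.baseChange L).toAffine.Point) (ht : (2 : ℕ) • t = 0)
    (R : (W.baseChange L).toAffine.Point) (hR : (2 : ℕ) • R = (∑ d ∈ v, g d) + t) :
    (∑ σ : L ≃ₐ[F] L, σ • R) = if D ∈ v then (2 : ℕ) • g D else 0 :=
  trace_half_eq_smul_four hG h2 (fun x hx σ => smul_eq_self_of_two_nsmul_eq_zero W h x hx σ) χ D hχ hD g hg v t ht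
    R hR

end Points

end Summit.BirchSwinnertonDyer.BirchSwinnertonDyer.Theorems.GenusKolyvaginAtTwo.FullVertex.GenusTrace

end
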